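import Summits.QuantumFields.YangMills.Theses.SqueezedSkewness
import Summits.QuantumFields.YangMills.Theorems.SqueezedSkewnessCovPolarisation
import Summits.QuantumFields.YangMills.Theorems.SqueezedSkewnessLowPassDFT
import Summits.QuantumFields.YangMills.Theorems.SqueezedSkewnessLatticeSumFloor
import Summits.QuantumFields.YangMills.Theorems.SqueezedSkewnessHBBumps

/-!
# `SqueezedSkewness.HighBallFloorsLPGlue` — PROVED (support stmt-QuantumFields-22797; LINE 2 «low-pass floor» of
# planner ym-idea-6 g8): `LowPassFloor → KLCoherence → SpectralIdentificationL → HighBallFloors`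

PROOF.  Take `(r, a)`, `ε`, `β₅`, `Λ₅` from `LowPassFloor`; for a bump `f ≥ 0`, `f ≠ 0` in `closedBall(2e₀, ½)` let `c₀, a₀`
be the lattice-sum floor (`c₀ ≤ a⁴Σ_x f(ax)` for `a ≤ a₀`, tree `lattice_sum_floor`).  For `β` large (`a(β) ≤ min a₀ 1`, `β ≥ β₅`,
`β ≥ 0`) and `a(β)L ≥ max Λ₅ 1`, put `s = a(β)`, `S = 2L+1`, `m = ⌊5/(2s)⌋`, and realise the route's lattice weights by
Schwartz bumps of radius `s/4` (tree `SqueezedSkewnessHBBumps`): `φ` at `s(m+1,0⃗)` (`= ind` on the torus sites, `amp_s φ = μ^m`)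
and `ψ = Σ_z κ(z)·bump_{s(m+1,cc z)}` (`= kap`, `amp_s ψ(μ, 2πq/(sS)) = μ^m·1[lp(q mod S)]` by the discrete Fourier inversion
`lowPass_dft`).  `SpectralIdentificationL` gives ONE family `(W, μ, q)` and limits/`HasSum`s for `f`, `φ+ψ`, `φ−ψ`; the
polarisation identity `4·M_k = Qrp_k(φ+ψ) − Qrp_k(φ−ψ)` (`cov_refl_polarisation`, reflection symmetry of Wilson's measure)
gives `M_k → M_∞ = Σ_n W_n μ_n^{2m} 1[lp(q̄_n)]`, so `ε s⁸ ≤ M_∞` (`LowPassFloor`); `KLCoherence` gives termwise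
`W_n‖amp_s f‖² ≥ ½ μ_n^{2m} (Σ_x f(sx))² 1[lp(q̄_n)] W_n`, hence `Q(f) ≥ ½(Σ_x f(sx))² M_∞ ≥ ½ (c₀/s⁴)² ε s⁸ = εc₀²/2`
(`glue_abstract`), and `Qrp_k(f) → Q(f)` is eventually `≥ εc₀²/4`.  The route's `Qrp`, `M`, `amp` are handled through opaque
local functionals (`QQ`, `CF`, `AMP`) fixed by definitional unfolding, so every transfer is literal.  HONEST SCOPE: plumbing of a
LINE onto `BalabanLadder.NT` (R2a); the cruxes `LowPassFloor`, `SpectralIdentificationL` remain hypotheses; nothing about NT or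
the YM mass gap is proved. No definitions. [folklore]
-/

noncomputable section

open scoped BigOperators
open MeasureTheory Filter Topology Set Metric Finset Complex
open Literature.MathematicalPhysics.QuantumLattice
open Literature.MathematicalPhysics.QuantumFieldTheory
open Summit.QuantumFields.YangMills.Theorems.ThermalDescentReflection
open Summit.QuantumFields.YangMills.Theorems.SqueezedSkewnessCovPolar
open Summit.QuantumFields.YangMills.Theorems.SqueezedSkewnessLowPassDFT
open Summit.QuantumFields.YangMills.Theorems.SqueezedSkewnessLatticeSumFloor
open Summit.QuantumFields.YangMills.Theorems.SqueezedSkewnessLatticeBumps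
open Summit.QuantumFields.YangMills.Theorems.SqueezedSkewnessHBAmps
open Summit.QuantumFields.YangMills.Theorems.SqueezedSkewnessHBBumps

namespace Summit.QuantumFields.YangMills.Theorems.SqueezedSkewnessHighBallFloorsLPGlue

/-- **`HighBallFloorsLPGlue` (stmt-QuantumFields-22797) HOLDS**: `LowPassFloor → KLCoherence → SpectralIdentificationL →
HighBallFloors`.  Plumbing of a line onto `BalabanLadder.NT`; no summit statement is affected. [folklore] -/
theorem highBallFloorsLPGlue_proof :
    Summit.QuantumFields.YangMills.Theses.SqueezedSkewness.HighBallFloorsLPGlue := by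
  intro hLP hKL hSI G i1 i2 i3 i4 hG
  obtain ⟨r, a, hLP'⟩ := hLP G hG
  refine ⟨r, a, ?_⟩
  dsimp only at hLP' ⊢
  obtain ⟨ha, ha0, ε, β₅, Λ₅, hε, hfloor⟩ := hLP'
  refine ⟨ha, ha0, fun f hf0 hfne hfball => ?_⟩
  letI : MeasurableSpace G := borel G
  haveI : BorelSpace G := ⟨rfl⟩
  haveI : SecondCountableTopology G :=
    (r.continuous.isClosedEmbedding r.injective).isEmbedding.secondCountableTopology
  have hfne' : (f : EuclideanSpace ℝ (Fin 4) → ℝ) ≠ 0 := by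
    intro h; apply hfne; ext y; simpa using congrFun h y
  have hfR : tsupport (f : EuclideanSpace ℝ (Fin 4) → ℝ) ⊆ Metric.closedBall (0 : EuclideanSpace ℝ (Fin 4)) 3 := by
    intro y hy
    have h := hfball hy
    rw [Metric.mem_closedBall] at h ⊢
    have h2 : dist (EuclideanSpace.single (0 : Fin 4) (2 : ℝ)) (0 : EuclideanSpace ℝ (Fin 4)) = 2 := by
      rw [dist_zero_right, PiLp.norm_single]; norm_num
    linarith [dist_triangle y (EuclideanSpace.single (0 : Fin 4) (2 : ℝ)) 0]
  obtain ⟨c₀, a₀, hc₀, ha₀, hfl⟩ := lattice_sum_floor f.continuous hf0 hfR hfne'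
  obtain ⟨β₆, hβ₆⟩ : ∃ β₆ : ℝ, ∀ β, β₆ ≤ β → a β < min a₀ 1 := by
    have h1 : ∀ᶠ β in atTop, a β < min a₀ 1 := ha0.eventually (gt_mem_nhds (lt_min ha₀ one_pos))
    exact Filter.eventually_atTop.mp h1
  refine ⟨ε * c₀ ^ 2 / 4, max β₅ (max β₆ 0), max Λ₅ 1, by positivity, ?_⟩
  intro β hβ L hL
  have hβ5 : β₅ ≤ β := le_trans (le_max_left _ _) hβ
  have hβ6 : β₆ ≤ β := le_trans (le_trans (le_max_left _ _) (le_max_right _ _)) hβ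
  have hβ0 : 0 ≤ β := le_trans (le_trans (le_max_right _ _) (le_max_right _ _)) hβ
  have hs : 0 < a β := ha β
  have hs1 : a β ≤ 1 := ((hβ₆ β hβ6).le.trans (min_le_right _ _))
  have hsa : a β ≤ a₀ := ((hβ₆ β hβ6).le.trans (min_le_left _ _))
  have hΛ : Λ₅ ≤ a β * L := le_trans (le_max_left _ _) hL
  have h1sL : 1 ≤ a β * L := le_trans (le_max_right _ _) hL
  have hL1 : 1 ≤ L := by
    exact_mod_cast (h1sL.trans (mul_le_of_le_one_left (Nat.cast_nonneg L) hs1) : (1 : ℝ) ≤ (L : ℝ))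
  set s : ℝ := a β with hs_def
  obtain ⟨k₀, hk₀⟩ := hfloor β hβ5 L hΛ
  have hSI' := hSI G r
  dsimp only at hSI'
  obtain ⟨W, μ, q, hW, hμ, hspec⟩ := hSI' β L s hβ0 hL1 hs
  have hKL' := hKL
  unfold Summit.QuantumFields.YangMills.Theses.SqueezedSkewness.KLCoherence at hKL'
  dsimp only at hKL'
  have hS : 0 < 2 * L + 1 := by omega
  set m : ℕ := ⌊5 / (2 * s)⌋₊ with hm_def
  obtain ⟨QQ, hQQ⟩ : ∃ QQ : (T : ℕ) → (FinTorusSite (2 * L + 1) (2 * L + 1) (2 * L + 1) T → ℝ) →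
      (FinTorusSite (2 * L + 1) (2 * L + 1) (2 * L + 1) T → ℝ) → ℝ, ∀ T c₁ c₂, QQ T c₁ c₂ =
      (∫ U : FinTorusSite (2 * L + 1) (2 * L + 1) (2 * L + 1) T × Fin 4 → G,
          (∑ x : FinTorusSite (2 * L + 1) (2 * L + 1) (2 * L + 1) T, c₁ x *
              ∑ q : {q : Fin 4 × Fin 4 // q.1 < q.2}, (r.ρ (finTorusPlaquette
                (fun e => if e.2 = Fin.last 3 then (U ((e.1.1, e.1.2.1, e.1.2.2.1, Fin.rev e.1.2.2.2), Fin.last 3))⁻¹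
                  else U ((e.1.1, e.1.2.1, e.1.2.2.1, ⟨(T - e.1.2.2.2.val) % T, Nat.mod_lt _ e.1.2.2.2.pos⟩), e.2))
                x q.1.1 q.1.2)).trace.re) *
            (∑ x : FinTorusSite (2 * L + 1) (2 * L + 1) (2 * L + 1) T, c₂ x *
              ∑ q : {q : Fin 4 × Fin 4 // q.1 < q.2}, (r.ρ (finTorusPlaquette U x q.1.1 q.1.2)).trace.re) *
          Real.exp (-β * ∑ x : FinTorusSite (2 * L + 1) (2 * L + 1) (2 * L + 1) T,
            ∑ q : {q : Fin 4 × Fin 4 // q.1 < q.2}, ((r.N : ℝ) - (r.ρ (finTorusPlaquette U x q.1.1 q.1.2)).trace.re))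
          ∂Measure.pi (fun _ => haarProbability G)) /
        wilsonFinTorusPartition r.ρ β (2 * L + 1) (2 * L + 1) (2 * L + 1) T -
      (∫ U : FinTorusSite (2 * L + 1) (2 * L + 1) (2 * L + 1) T × Fin 4 → G,
          (∑ x : FinTorusSite (2 * L + 1) (2 * L + 1) (2 * L + 1) T, c₁ x *
              ∑ q : {q : Fin 4 × Fin 4 // q.1 < q.2}, (r.ρ (finTorusPlaquette
                (fun e => if e.2 = Fin.last 3 then (U ((e.1.1, e.1.2.1, e.1.2.2.1, Fin.rev e.1.2.2.2), Fin.last 3))⁻¹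
                  else U ((e.1.1, e.1.2.1, e.1.2.2.1, ⟨(T - e.1.2.2.2.val) % T, Nat.mod_lt _ e.1.2.2.2.pos⟩), e.2))
                x q.1.1 q.1.2)).trace.re) *
          Real.exp (-β * ∑ x : FinTorusSite (2 * L + 1) (2 * L + 1) (2 * L + 1) T,
            ∑ q : {q : Fin 4 × Fin 4 // q.1 < q.2}, ((r.N : ℝ) - (r.ρ (finTorusPlaquette U x q.1.1 q.1.2)).trace.re))
          ∂Measure.pi (fun _ => haarProbability G)) /
        wilsonFinTorusPartition r.ρ β (2 * L + 1) (2 * L + 1) (2 * L + 1) T *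
      ((∫ U : FinTorusSite (2 * L + 1) (2 * L + 1) (2 * L + 1) T × Fin 4 → G,
          (∑ x : FinTorusSite (2 * L + 1) (2 * L + 1) (2 * L + 1) T, c₂ x *
              ∑ q : {q : Fin 4 × Fin 4 // q.1 < q.2}, (r.ρ (finTorusPlaquette U x q.1.1 q.1.2)).trace.re) *
          Real.exp (-β * ∑ x : FinTorusSite (2 * L + 1) (2 * L + 1) (2 * L + 1) T,
            ∑ q : {q : Fin 4 × Fin 4 // q.1 < q.2}, ((r.N : ℝ) - (r.ρ (finTorusPlaquette U x q.1.1 q.1.2)).trace.re))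
          ∂Measure.pi (fun _ => haarProbability G)) /
        wilsonFinTorusPartition r.ρ β (2 * L + 1) (2 * L + 1) (2 * L + 1) T) := ⟨_, fun _ _ _ => rfl⟩
  obtain ⟨κR, hκR⟩ : ∃ κR : Fin (2 * L + 1) × Fin (2 * L + 1) × Fin (2 * L + 1) → ℝ, ∀ z, κR z =
      (1 / ((2 * L + 1 : ℕ) : ℝ) ^ 3) * ∑ q : Fin (2 * L + 1) × Fin (2 * L + 1) × Fin (2 * L + 1),
        (if (2 / s ^ 2) * ((1 - Real.cos (2 * Real.pi * q.1.val / ((2 * L + 1 : ℕ) : ℝ))) +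
            (1 - Real.cos (2 * Real.pi * q.2.1.val / ((2 * L + 1 : ℕ) : ℝ))) +
            (1 - Real.cos (2 * Real.pi * q.2.2.val / ((2 * L + 1 : ℕ) : ℝ)))) ≤ 1 then
          Real.cos (2 * Real.pi * ((q.1.val * z.1.val + q.2.1.val * z.2.1.val + q.2.2.val * z.2.2.val : ℕ) : ℝ) /
            ((2 * L + 1 : ℕ) : ℝ)) else 0) := ⟨_, fun _ => rfl⟩
  obtain ⟨indT, hindT⟩ : ∃ indT : (T : ℕ) → FinTorusSite (2 * L + 1) (2 * L + 1) (2 * L + 1) T → ℝ, ∀ T x,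
      indT T x = if x.2.2.2.val = m + 1 ∧ x.1.val = 0 ∧ x.2.1.val = 0 ∧ x.2.2.1.val = 0 then 1 else 0 :=
    ⟨_, fun _ _ => rfl⟩
  obtain ⟨kapT, hkapT⟩ : ∃ kapT : (T : ℕ) → FinTorusSite (2 * L + 1) (2 * L + 1) (2 * L + 1) T → ℝ, ∀ T x,
      kapT T x = if x.2.2.2.val = m + 1 then κR (x.1, x.2.1, x.2.2.1) else 0 := ⟨_, fun _ _ => rfl⟩
  have hflT : ∀ k, k₀ ≤ k →
      ε * s ^ 8 ≤ QQ (2 ^ k * (2 * L + 1)) (indT (2 ^ k * (2 * L + 1))) (kapT (2 ^ k * (2 * L + 1))) := by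
    intro k hk
    rw [hQQ]
    simp only [hindT, hkapT, hκR]
    exact hk₀ k hk
  have hpolT : ∀ (T : ℕ) (c₁ c₂ : FinTorusSite (2 * L + 1) (2 * L + 1) (2 * L + 1) T → ℝ),
      4 * QQ T c₁ c₂ = QQ T (fun x => c₁ x + c₂ x) (fun x => c₁ x + c₂ x) -
        QQ T (fun x => c₁ x - c₂ x) (fun x => c₁ x - c₂ x) := by
    intro T c₁ c₂
    rw [hQQ, hQQ, hQQ]
    exact cov_refl_polarisation r.ρ β (wilsonFinTorusPartition r.ρ β (2 * L + 1) (2 * L + 1) (2 * L + 1) T)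
      r.continuous
      (fun U e => if e.2 = Fin.last 3 then (U ((e.1.1, e.1.2.1, e.1.2.2.1, Fin.rev e.1.2.2.2), Fin.last 3))⁻¹
        else U ((e.1.1, e.1.2.1, e.1.2.2.1, ⟨(T - e.1.2.2.2.val) % T, Nat.mod_lt _ e.1.2.2.2.pos⟩), e.2))
      (fun U => rfl) c₁ c₂
  obtain ⟨AMP, hAMP⟩ : ∃ AMP : SchwartzMap (EuclideanSpace ℝ (Fin 4)) ℝ → ℕ → ℂ, ∀ g n, AMP g n =
      ∑' x : Fin 4 → ℤ, (((g (s • siteToE (d := 4) x) * μ n ^ (Int.toNat (x 0 - 1))) : ℝ) : ℂ) *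
        cexp (I * ((s * ∑ k : Fin 3, (2 * Real.pi * (q n k : ℝ) / (s * (2 * L + 1))) * (x k.succ : ℝ) : ℝ) : ℂ)) :=
    ⟨_, fun _ _ => rfl⟩
  obtain ⟨CF, hCF⟩ : ∃ CF : (T : ℕ) → SchwartzMap (EuclideanSpace ℝ (Fin 4)) ℝ →
      FinTorusSite (2 * L + 1) (2 * L + 1) (2 * L + 1) T → ℝ, ∀ T g x, CF T g x =
      g (s • siteToE (d := 4) ![(if 2 * x.2.2.2.val < T then (x.2.2.2.val : ℤ) else (x.2.2.2.val : ℤ) - T),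
        (if 2 * x.1.val < 2 * L + 1 then (x.1.val : ℤ) else (x.1.val : ℤ) - (2 * L + 1 : ℕ)),
        (if 2 * x.2.1.val < 2 * L + 1 then (x.2.1.val : ℤ) else (x.2.1.val : ℤ) - (2 * L + 1 : ℕ)),
        (if 2 * x.2.2.1.val < 2 * L + 1 then (x.2.2.1.val : ℤ) else (x.2.2.1.val : ℤ) - (2 * L + 1 : ℕ))]) :=
    ⟨_, fun _ _ _ => rfl⟩
  have hspecT : ∀ (H : ℝ) (g : SchwartzMap (EuclideanSpace ℝ (Fin 4)) ℝ),
      tsupport (g : EuclideanSpace ℝ (Fin 4) → ℝ) ⊆ {y | 0 < y 0 ∧ y 0 ≤ H} →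
      tsupport (g : EuclideanSpace ℝ (Fin 4) → ℝ) ⊆ {y | ∀ i : Fin 3, |y i.succ| < s * (L + 1 / 2)} →
      ∃ Q : ℝ, Tendsto (fun k => QQ (2 ^ k * (2 * L + 1)) (CF (2 ^ k * (2 * L + 1)) g) (CF (2 ^ k * (2 * L + 1)) g))
        atTop (𝓝 Q) ∧ HasSum (fun n => W n * ‖AMP g n‖ ^ 2) Q := by
    intro H g h1 h2
    simp only [hQQ, hCF, hAMP]
    exact hspec H g h1 h2
  have hCFadd : ∀ (T : ℕ) (g h : SchwartzMap (EuclideanSpace ℝ (Fin 4)) ℝ) x, CF T (g + h) x = CF T g x + CF T h x := by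
    intro T g h x; simp only [hCF, add_apply]
  have hCFsub : ∀ (T : ℕ) (g h : SchwartzMap (EuclideanSpace ℝ (Fin 4)) ℝ) x, CF T (g - h) x = CF T g x - CF T h x := by
    intro T g h x; simp only [hCF, sub_apply]
  have hSR : ((2 * L + 1 : ℕ) : ℝ) = 2 * (L : ℝ) + 1 := by push_cast; ring
  have hm1 : Int.toNat (((m + 1 : ℕ) : ℤ) - 1) = m := by simp
  obtain ⟨χ, hχ⟩ : ∃ χ : Fin (2 * L + 1) × Fin (2 * L + 1) × Fin (2 * L + 1) → ℝ, ∀ q', χ q' =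
      if (2 / s ^ 2) * ((1 - Real.cos (2 * Real.pi * q'.1.val / ((2 * L + 1 : ℕ) : ℝ))) +
          (1 - Real.cos (2 * Real.pi * q'.2.1.val / ((2 * L + 1 : ℕ) : ℝ))) +
          (1 - Real.cos (2 * Real.pi * q'.2.2.val / ((2 * L + 1 : ℕ) : ℝ)))) ≤ 1 then 1 else 0 := ⟨_, fun _ => rfl⟩
  obtain ⟨κχ, hκχ⟩ : ∃ κχ : Fin (2 * L + 1) × Fin (2 * L + 1) × Fin (2 * L + 1) → ℝ, ∀ z, κχ z =
      (1 / ((2 * L + 1 : ℕ) : ℝ) ^ 3) * ∑ q' : Fin (2 * L + 1) × Fin (2 * L + 1) × Fin (2 * L + 1),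
        χ q' * Real.cos (2 * Real.pi *
          ((q'.1.val * z.1.val + q'.2.1.val * z.2.1.val + q'.2.2.val * z.2.2.val : ℕ) : ℝ) / ((2 * L + 1 : ℕ) : ℝ)) :=
    ⟨_, fun _ => rfl⟩
  have hκRχ : ∀ z, κR z = κχ z := by
    intro z; rw [hκR, hκχ]; congr 1
    refine Finset.sum_congr rfl fun q' _ => ?_
    rw [hχ]; split_ifs <;> simp
  have hsymm : ∀ q₁ q₂ : Fin (2 * L + 1) × Fin (2 * L + 1) × Fin (2 * L + 1),
      (2 * L + 1) ∣ q₁.1.val + q₂.1.val → (2 * L + 1) ∣ q₁.2.1.val + q₂.2.1.val →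
      (2 * L + 1) ∣ q₁.2.2.val + q₂.2.2.val → χ q₁ = χ q₂ := by
    intro q₁ q₂ h1 h2 h3
    rw [hχ, hχ, cos_dvd_add _ hS _ _ h1, cos_dvd_add _ hS _ _ h2, cos_dvd_add _ hS _ _ h3]
  obtain ⟨qb, hqb⟩ : ∃ qb : ℕ → Fin (2 * L + 1) × Fin (2 * L + 1) × Fin (2 * L + 1), ∀ n, qb n =
      (⟨((q n 0) % ((2 * L + 1 : ℕ) : ℤ)).toNat, toNat_emod_lt (2 * L + 1) hS (q n 0)⟩,
        ⟨((q n 1) % ((2 * L + 1 : ℕ) : ℤ)).toNat, toNat_emod_lt (2 * L + 1) hS (q n 1)⟩,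
        ⟨((q n 2) % ((2 * L + 1 : ℕ) : ℤ)).toNat, toNat_emod_lt (2 * L + 1) hS (q n 2)⟩) := ⟨_, fun _ => rfl⟩
  have hχqb : ∀ n, χ (qb n) =
      if (2 / s ^ 2) * ((1 - Real.cos (2 * Real.pi * ((((q n 0) % ((2 * L + 1 : ℕ) : ℤ)).toNat : ℕ) : ℝ) /
            ((2 * L + 1 : ℕ) : ℝ))) +
          (1 - Real.cos (2 * Real.pi * ((((q n 1) % ((2 * L + 1 : ℕ) : ℤ)).toNat : ℕ) : ℝ) / ((2 * L + 1 : ℕ) : ℝ))) +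
          (1 - Real.cos (2 * Real.pi * ((((q n 2) % ((2 * L + 1 : ℕ) : ℤ)).toNat : ℕ) : ℝ) / ((2 * L + 1 : ℕ) : ℝ))))
          ≤ 1 then 1 else 0 := by
    intro n; rw [hqb, hχ]
  obtain ⟨φ, hφc, hφs, hφv, hφa⟩ := exists_bump hs ![((m + 1 : ℕ) : ℤ), 0, 0, 0]
  choose Bz hBc hBs hBv hBa using fun z : Fin (2 * L + 1) × Fin (2 * L + 1) × Fin (2 * L + 1) =>
    exists_bump hs ![((m + 1 : ℕ) : ℤ),
      (if 2 * z.1.val < 2 * L + 1 then (z.1.val : ℤ) else (z.1.val : ℤ) - (2 * L + 1 : ℕ)),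
      (if 2 * z.2.1.val < 2 * L + 1 then (z.2.1.val : ℤ) else (z.2.1.val : ℤ) - (2 * L + 1 : ℕ)),
      (if 2 * z.2.2.val < 2 * L + 1 then (z.2.2.val : ℤ) else (z.2.2.val : ℤ) - (2 * L + 1 : ℕ))]
  set ψ : SchwartzMap (EuclideanSpace ℝ (Fin 4)) ℝ := ∑ z, κχ z • Bz z with hψ_def
  have hψv : ∀ y, ψ y = ∑ z, κχ z * Bz z y := fun y => sum_smul_apply κχ Bz y
  have hψsupp : tsupport (ψ : EuclideanSpace ℝ (Fin 4) → ℝ) ⊆ ⋃ z, tsupport (Bz z : EuclideanSpace ℝ (Fin 4) → ℝ) :=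
    tsupport_sum_smul_subset κχ Bz
  have hψc : HasCompactSupport (ψ : EuclideanSpace ℝ (Fin 4) → ℝ) := hasCompactSupport_sum_smul κχ Bz hBc
  have hfc : HasCompactSupport (f : EuclideanSpace ℝ (Fin 4) → ℝ) :=
    (isCompact_closedBall (0 : EuclideanSpace ℝ (Fin 4)) 3).of_isClosed_subset (isClosed_tsupport _) hfR
  have hφslab : tsupport (φ : EuclideanSpace ℝ (Fin 4) → ℝ) ⊆ {y | 0 < y 0 ∧ y 0 ≤ s * ((m + 1 : ℕ) + 1)} ∧
      tsupport (φ : EuclideanSpace ℝ (Fin 4) → ℝ) ⊆ {y | ∀ i : Fin 3, |y i.succ| < s * (L + 1 / 2)} := by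
    have key := fun y (hy : y ∈ tsupport (φ : EuclideanSpace ℝ (Fin 4) → ℝ)) =>
      slab_cube hs L (m + 1) (by omega) 0 0 0 (by simp) (by simp) (by simp) (hφs hy)
    exact ⟨fun y hy => (key y hy).1, fun y hy => (key y hy).2⟩
  have hψslab : tsupport (ψ : EuclideanSpace ℝ (Fin 4) → ℝ) ⊆ {y | 0 < y 0 ∧ y 0 ≤ s * ((m + 1 : ℕ) + 1)} ∧
      tsupport (ψ : EuclideanSpace ℝ (Fin 4) → ℝ) ⊆ {y | ∀ i : Fin 3, |y i.succ| < s * (L + 1 / 2)} := by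
    have key : ∀ y ∈ tsupport (ψ : EuclideanSpace ℝ (Fin 4) → ℝ),
        (0 < y 0 ∧ y 0 ≤ s * ((m + 1 : ℕ) + 1)) ∧ ∀ i : Fin 3, |y i.succ| < s * (L + 1 / 2) := by
      intro y hy
      obtain ⟨z, hz⟩ := Set.mem_iUnion.mp (hψsupp hy)
      exact slab_cube hs L (m + 1) (by omega) _ _ _ (abs_cc_le L z.1) (abs_cc_le L z.2.1) (abs_cc_le L z.2.2)
        (hBs z hz)
    exact ⟨fun y hy => (key y hy).1, fun y hy => (key y hy).2⟩
  have hfslab := slab_of_ball_two (f : EuclideanSpace ℝ (Fin 4) → ℝ) hs h1sL hfball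
  have hPslab := And.intro ((tsupport_add_subset' φ ψ).trans (Set.union_subset hφslab.1 hψslab.1))
    ((tsupport_add_subset' φ ψ).trans (Set.union_subset hφslab.2 hψslab.2))
  have hMslab := And.intro ((tsupport_sub_subset' φ ψ).trans (Set.union_subset hφslab.1 hψslab.1))
    ((tsupport_sub_subset' φ ψ).trans (Set.union_subset hφslab.2 hψslab.2))
  have hcoef : ∀ T : ℕ, 2 * (m + 1) < T → ∀ x : FinTorusSite (2 * L + 1) (2 * L + 1) (2 * L + 1) T,
      CF T φ x = indT T x ∧ CF T ψ x = kapT T x := by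
    intro T hT x
    have h4 := cc_eq_iff T x.2.2.2 (m + 1) hT
    have h1 := cc_eq_iff (2 * L + 1) x.1 0 (by omega)
    have h2 := cc_eq_iff (2 * L + 1) x.2.1 0 (by omega)
    have h3 := cc_eq_iff (2 * L + 1) x.2.2.1 0 (by omega)
    simp only [Nat.cast_zero] at h1 h2 h3
    rw [hCF, hCF, hindT, hkapT, hφv, hψv]
    constructor
    · refine if_congr ?_ rfl rfl
      rw [vec4_eq_iff]
      constructor
      · rintro ⟨a0, a1, a2, a3⟩
        exact ⟨h4.mp a0.symm, h1.mp a1.symm, h2.mp a2.symm, h3.mp a3.symm⟩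
      · rintro ⟨b0, b1, b2, b3⟩
        exact ⟨(h4.mpr b0).symm, (h1.mpr b1).symm, (h2.mpr b2).symm, (h3.mpr b3).symm⟩
    · simp only [hBv]
      have hz : ∀ z : Fin (2 * L + 1) × Fin (2 * L + 1) × Fin (2 * L + 1),
          ((![((m + 1 : ℕ) : ℤ),
              (if 2 * z.1.val < 2 * L + 1 then (z.1.val : ℤ) else (z.1.val : ℤ) - (2 * L + 1 : ℕ)),
              (if 2 * z.2.1.val < 2 * L + 1 then (z.2.1.val : ℤ) else (z.2.1.val : ℤ) - (2 * L + 1 : ℕ)),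
              (if 2 * z.2.2.val < 2 * L + 1 then (z.2.2.val : ℤ) else (z.2.2.val : ℤ) - (2 * L + 1 : ℕ))]
              : Fin 4 → ℤ) =
            ![(if 2 * x.2.2.2.val < T then (x.2.2.2.val : ℤ) else (x.2.2.2.val : ℤ) - T),
              (if 2 * x.1.val < 2 * L + 1 then (x.1.val : ℤ) else (x.1.val : ℤ) - (2 * L + 1 : ℕ)),
              (if 2 * x.2.1.val < 2 * L + 1 then (x.2.1.val : ℤ) else (x.2.1.val : ℤ) - (2 * L + 1 : ℕ)),
              (if 2 * x.2.2.1.val < 2 * L + 1 then (x.2.2.1.val : ℤ) else (x.2.2.1.val : ℤ) - (2 * L + 1 : ℕ))])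
          ↔ (x.2.2.2.val = m + 1 ∧ z = (x.1, x.2.1, x.2.2.1)) := by
        intro z
        rw [vec4_eq_iff]
        constructor
        · rintro ⟨a0, a1, a2, a3⟩
          refine ⟨h4.mp a0.symm, ?_⟩
          have e1 := cc_injective (2 * L + 1) a1
          have e2 := cc_injective (2 * L + 1) a2
          have e3 := cc_injective (2 * L + 1) a3
          exact Prod.ext e1 (Prod.ext e2 e3)
        · rintro ⟨b0, rfl⟩
          exact ⟨(h4.mpr b0).symm, rfl, rfl, rfl⟩
      simp only [hz]
      by_cases hx4 : x.2.2.2.val = m + 1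
      · simp only [hx4, true_and, if_true, mul_ite, mul_one, mul_zero, Finset.sum_ite_eq', Finset.mem_univ]
        rw [hκRχ]
      · simp [hx4]
  have hAφ : ∀ n, AMP φ n = ((μ n ^ m : ℝ) : ℂ) := by
    intro n
    rw [hAMP, hφa]
    simp [Fin.sum_univ_three]
  have hAB : ∀ z n, AMP (Bz z) n = ((μ n ^ m : ℝ) : ℂ) *
      cexp (2 * Real.pi * I * ((q n 0 : ℂ) * ((z.1 : ℕ) : ℂ) + (q n 1 : ℂ) * ((z.2.1 : ℕ) : ℂ) +
        (q n 2 : ℂ) * ((z.2.2 : ℕ) : ℂ)) / ((2 * L + 1 : ℕ) : ℂ)) := by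
    intro z n
    rw [hAMP, hBa]
    have hph := phase_cc hs.ne' (2 * L + 1) hS (q n) ((m + 1 : ℕ) : ℤ) z
    rw [hSR] at hph
    rw [hph]
    simp only [Matrix.cons_val_zero, hm1]
  have hAψ : ∀ n, AMP ψ n = ((μ n ^ m * χ (qb n) : ℝ) : ℂ) := by
    intro n
    rw [hAMP, hψ_def, latticeSum_sum_smul κχ Bz hs hBc]
    have hAB' : ∀ z, ∑' x : Fin 4 → ℤ,
        ((((Bz z (s • siteToE (d := 4) x) * μ n ^ (Int.toNat (x 0 - 1))) : ℝ) : ℂ) *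
          cexp (I * ((s * ∑ k : Fin 3, (2 * Real.pi * (q n k : ℝ) / (s * (2 * L + 1))) * (x k.succ : ℝ) : ℝ) : ℂ)))
        = ((μ n ^ m : ℝ) : ℂ) *
          cexp (2 * Real.pi * I * ((q n 0 : ℂ) * ((z.1 : ℕ) : ℂ) + (q n 1 : ℂ) * ((z.2.1 : ℕ) : ℂ) +
            (q n 2 : ℂ) * ((z.2.2 : ℕ) : ℂ)) / ((2 * L + 1 : ℕ) : ℂ)) := by
      intro z; rw [← hAB z n, hAMP]
    simp only [hAB']
    have hfac : ∑ z : Fin (2 * L + 1) × Fin (2 * L + 1) × Fin (2 * L + 1), (κχ z : ℂ) * (((μ n ^ m : ℝ) : ℂ) *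
          cexp (2 * Real.pi * I * ((q n 0 : ℂ) * ((z.1 : ℕ) : ℂ) + (q n 1 : ℂ) * ((z.2.1 : ℕ) : ℂ) +
            (q n 2 : ℂ) * ((z.2.2 : ℕ) : ℂ)) / ((2 * L + 1 : ℕ) : ℂ)))
        = ((μ n ^ m : ℝ) : ℂ) * ∑ z : Fin (2 * L + 1) × Fin (2 * L + 1) × Fin (2 * L + 1), (κχ z : ℂ) *
          cexp (2 * Real.pi * I * ((q n 0 : ℂ) * ((z.1 : ℕ) : ℂ) + (q n 1 : ℂ) * ((z.2.1 : ℕ) : ℂ) +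
            (q n 2 : ℂ) * ((z.2.2 : ℕ) : ℂ)) / ((2 * L + 1 : ℕ) : ℂ)) := by
      rw [Finset.mul_sum]
      refine Finset.sum_congr rfl fun z _ => ?_
      ring
    rw [hfac]
    simp only [hκχ]
    rw [lowPass_dft (2 * L + 1) hS χ hsymm (q n 0) (q n 1) (q n 2), hqb]
    push_cast
    ring
  have hAadd : ∀ n, AMP (φ + ψ) n = AMP φ n + AMP ψ n := by
    intro n; rw [hAMP, hAMP, hAMP]; exact latticeSum_add φ ψ hs hφc hψc _ _
  have hAsub : ∀ n, AMP (φ - ψ) n = AMP φ n - AMP ψ n := by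
    intro n; rw [hAMP, hAMP, hAMP]; exact latticeSum_sub φ ψ hs hφc hψc _ _
  have hD : ∀ n, ‖AMP (φ + ψ) n‖ ^ 2 - ‖AMP (φ - ψ) n‖ ^ 2 = 4 * (μ n ^ (2 * m) * χ (qb n)) := by
    intro n
    rw [hAadd, hAsub, hAφ, hAψ, norm_sq_add_sub_norm_sq_sub]
    ring
  have hKLn : ∀ n, 1 / 2 * (μ n ^ (2 * m) * χ (qb n)) * (∑' x : Fin 4 → ℤ, f (s • siteToE (d := 4) x)) ^ 2
      ≤ ‖AMP f n‖ ^ 2 := by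
    intro n
    by_cases hlp : (2 / s ^ 2) * ((1 - Real.cos (2 * Real.pi * ((((q n 0) % ((2 * L + 1 : ℕ) : ℤ)).toNat : ℕ) : ℝ) /
            ((2 * L + 1 : ℕ) : ℝ))) +
          (1 - Real.cos (2 * Real.pi * ((((q n 1) % ((2 * L + 1 : ℕ) : ℤ)).toNat : ℕ) : ℝ) / ((2 * L + 1 : ℕ) : ℝ))) +
          (1 - Real.cos (2 * Real.pi * ((((q n 2) % ((2 * L + 1 : ℕ) : ℤ)).toNat : ℕ) : ℝ) / ((2 * L + 1 : ℕ) : ℝ))))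
          ≤ 1
    · have hχ1 : χ (qb n) = 1 := by rw [hχqb, if_pos hlp]
      rw [hχ1, mul_one, hAMP]
      have hc : ∀ i : Fin 3, Real.cos (s * (2 * Real.pi * (q n i : ℝ) / (s * (2 * L + 1))))
          = Real.cos (2 * Real.pi * ((((q n i) % ((2 * L + 1 : ℕ) : ℤ)).toNat : ℕ) : ℝ) / ((2 * L + 1 : ℕ) : ℝ)) := by
        intro i
        rw [cos_mod_eq (2 * L + 1) hS (q n i), hSR]
        congr 1
        field_simp
      have hcond : 2 / s ^ 2 * ∑ i : Fin 3, (1 - Real.cos (s * (2 * Real.pi * (q n i : ℝ) / (s * (2 * L + 1))))) ≤ 1 := by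
        rw [Fin.sum_univ_three, hc 0, hc 1, hc 2]
        exact hlp
      exact hKL' s (μ n) (fun i => 2 * Real.pi * (q n i : ℝ) / (s * (2 * L + 1))) f hs hs1 (hμ n).1 (hμ n).2 hf0
        hfball hcond
    · have hχ0 : χ (qb n) = 0 := by rw [hχqb, if_neg hlp]
      rw [hχ0]
      simp only [mul_zero, zero_mul]
      positivity
  obtain ⟨Qf, hQf, hSf⟩ := hspecT (5 / 2) f hfslab.1 hfslab.2
  obtain ⟨Qp, hQp, hSp⟩ := hspecT (s * ((m + 1 : ℕ) + 1)) (φ + ψ) hPslab.1 hPslab.2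
  obtain ⟨Qm, hQm, hSm⟩ := hspecT (s * ((m + 1 : ℕ) + 1)) (φ - ψ) hMslab.1 hMslab.2
  have hevent : ∀ᶠ k in atTop, 2 * (m + 1) < 2 ^ k * (2 * L + 1) := eventually_lt_two_pow_mul _ _ hS
  have hpol : ∀ᶠ k in atTop, 4 * QQ (2 ^ k * (2 * L + 1)) (indT (2 ^ k * (2 * L + 1))) (kapT (2 ^ k * (2 * L + 1)))
      = QQ (2 ^ k * (2 * L + 1)) (CF (2 ^ k * (2 * L + 1)) (φ + ψ)) (CF (2 ^ k * (2 * L + 1)) (φ + ψ))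
        - QQ (2 ^ k * (2 * L + 1)) (CF (2 ^ k * (2 * L + 1)) (φ - ψ)) (CF (2 ^ k * (2 * L + 1)) (φ - ψ)) := by
    filter_upwards [hevent] with k hk
    have e1 : CF (2 ^ k * (2 * L + 1)) (φ + ψ) = fun x => indT _ x + kapT _ x := by
      funext x; rw [hCFadd, (hcoef _ hk x).1, (hcoef _ hk x).2]
    have e2 : CF (2 ^ k * (2 * L + 1)) (φ - ψ) = fun x => indT _ x - kapT _ x := by
      funext x; rw [hCFsub, (hcoef _ hk x).1, (hcoef _ hk x).2]
    rw [e1, e2]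
    exact hpolT _ _ _
  have hfl' : ∀ᶠ k in atTop,
      ε * s ^ 8 ≤ QQ (2 ^ k * (2 * L + 1)) (indT (2 ^ k * (2 * L + 1))) (kapT (2 ^ k * (2 * L + 1))) :=
    Filter.eventually_atTop.mpr ⟨k₀, hflT⟩
  have hσ : c₀ / s ^ 4 ≤ ∑' x : Fin 4 → ℤ, f (s • siteToE (d := 4) x) := by
    rw [div_le_iff₀ (pow_pos hs 4), mul_comm]
    exact hfl s hs hsa
  have key := glue_abstract hQp hQm hpol hfl' hSf hSp hSm hW hD hKLn (by positivity)
    (by positivity : (0 : ℝ) < c₀ / s ^ 4) hσ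
  have hval : 1 / 2 * (c₀ / s ^ 4) ^ 2 * (ε * s ^ 8) = ε * c₀ ^ 2 / 2 := by
    field_simp
  rw [hval] at key
  have hlt : ε * c₀ ^ 2 / 4 < Qf := by
    have : 0 < ε * c₀ ^ 2 := by positivity
    linarith
  obtain ⟨k₁, hk₁⟩ := tendsto_eventually_ge_of_lt hQf hlt
  refine ⟨k₁, fun k hk => ?_⟩
  have hfin := hk₁ k hk
  simp only [hQQ, hCF] at hfin
  exact hfin

end Summit.QuantumFields.YangMills.Theorems.SqueezedSkewnessHighBallFloorsLPGlue

end
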